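import Literature.MathematicalPhysics.QuantumFieldTheory.Balaban1983to89.B9Thm31SiteGpBoundsReg335Y
import Literature.MathematicalPhysics.QuantumFieldTheory.Balaban1983to89.B9Thm311PosAtRecordV4

/-!
# `Balaban1983to89.B9Thm32SiteXBoundsY` — T. Bałaban, *Propagators for lattice gauge theories in a background field*, Commun. Math. Phys. **99** (1985)
# 389–434 [Balaban1985BackgroundPropagators] Thm 3.2 (3.48) p. 398 ∕ (3.25) pp. 394–395 ∕ Thm 3.11 p. 416 with [4] = [Balaban1984PropagatorsII] Prop 2.3 p. 238:
# ★ **THEOREM 3.11's THIRD OPERATOR, QUANTITATIVELY — THE TWO-SIDED `L²` BOUNDS OF def-Y's `(Q′G′²Q′\*)(U)` AND `C(U) = (Q′G′²Q′\*)⁻¹(U)`**: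
# `(Q′G′²Q′\*)(U) ≥ (4(d+1)+1)⁻²` in the block-volume pairing at EVERY unitary-valued background (no smallness), `≤ 64·L^{4k}` on the (3.35) class; hence
# `‖C(U)h‖_W ≤ (4(d+1)+1)²‖h‖_W` uniformly (file 12 of the site-coercivity set of width seat `pub-ymgap-dag-n06-w1`)

statement-level skeleton of published theorems with citation tags; proofs where landed; nothing here is a claim about the Yang–Mills mass gap

THE PRINT.  (3.25) pp. 394–395: *«Rf = (I − G′Q′\*(Q′G′²Q′\*)⁻¹Q′G′)f … Assuming some regularity of the configuration U it can be easily shown that the operator Δ′_a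
is positive. This implies positivity of the operators G′, Q′G′²Q′\*, hence the existence of the operator R.»*; Thm 3.2 p. 398: *«Under the assumptions of
Theorem 3.1, and with the same constants, the following inequality holds: |(Q′(U)G′²(U)Q′\*(U))⁻¹(y,y′)| ≤ B₀(Lʲη)⁻²(Lʲ′η)^{−d}e^{−δ₀d(y,y′)} (3.48)»* (print:
*«a theorem analogous to Proposition 2.3 of [4]»*); Thm 3.11 p. 416: *«the operators Δ′_a, G′, (Q′G′²Q′\*)⁻¹, Δ_a, G are positive definite»*.

WHY THIS FILE.  dag-n06-j proved the QUALITATIVE statements at def-Y's v4 letters (`B9Thm311PosAtRecordV4.XY_parSymY_posDefTr`, `isUnit_XY_parSymY`,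
`XinvY_parSymY_posDefTr`: `(Q′G′²Q′\*)(U) > 0` at every `G`-valued `U`, by [3] p. 25's argument — `G′` symmetric positive, `Q′\*` injective).  File 4 of this
seat (`B9Thm31SiteGpBoundsReg335Y`) made `G′` QUANTITATIVE: `‖Ψ‖² ≤ (4(d+1)+1)·⟨Ψ, G′(U)Ψ⟩` at every unitary background and `‖G′(U)Ψ‖ ≤ 8L^{2k}‖Ψ‖` on the
class.  THIS FILE makes the third operator quantitative by the same two inputs plus the EXACT isometry `‖Q′\*(U)g‖₁ = ‖g‖_W` (the adjoint of the covariant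
block average is the transported extension by constants; the transporters are unitary): `⟨g, (Q′G′²Q′\*)(U)g⟩_W = ‖G′(U)Q′\*(U)g‖²₁ ≥ ‖Q′\*g‖²₁∕(4(d+1)+1)² =
‖g‖²_W∕(4(d+1)+1)²` — a member-, volume-, `k`-, `N`- and `U`-UNIFORM coercivity with NO smallness; the Lax–Milgram bookkeeping of file 4 then bounds `C(U)`.

WHAT IS PROVED (sorry-free; 0 `def`; nothing of [B9] asserted beyond what is proved).
* §1 `trIP_self_le_sq_mul_of_le` (`‖Ψ‖² ≤ M⟨Ψ, TΨ⟩ ⇒ ‖Ψ‖² ≤ M²‖TΨ‖²`), ★ `trIP_one_QpsY_self_eq` (`‖Q′\*(U)g‖²₁ = ‖g‖²_W`, `G`-valued table, `G ≤ U(N)`),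
  `trIP_wB_XY_eq` (`⟨g, (Q′G′²Q′\*)g⟩_W = ‖G′Q′\*g‖²₁` at `parSymY`), `isSymmTr_XY_parSymY`.
* §2 ★★★ **`trIP_XY_parSymY_ge`** (`(4(d+1)+1)⁻²·‖g‖²_W ≤ ⟨g, (Q′G′²Q′\*)(U)g⟩_W` at EVERY `G`-valued `U`, `G ≤ U(N)`), ★★ `trIP_XY_parSymY_le` (`≤ (8(L^k)²)²·‖g‖²_W` on
  the class), and for `C(U) = XinvY`: ★★★ **`trIP_XinvY_parSymY_self_le`** (`‖C(U)h‖²_W ≤ ((4(d+1)+1)²)²‖h‖²_W`), ★★ `trIP_XinvY_parSymY_le`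
  (`⟨h, C(U)h⟩_W ≤ (4(d+1)+1)²‖h‖²_W`), ★★ `trIP_self_le_XinvY_parSymY` (`‖h‖²_W ≤ (8(L^k)²)²·⟨h, C(U)h⟩_W` on the class).
MODEL ∕ DECLARED READINGS.  def-Y's letters `XY i (parSymY i) (GpY i (parSymY i)) U = Q′(U)G′(U)²Q′\*(U)` and `XinvY = Ring.inverse` (lattice units, block
functions `BlkY i → M_N(ℂ)`), the block-volume pairing `trIP (wB i)` of dag-n06-j (print's `(Lʲη)^d`-weighted sums up to the common factor); print's (3.48)
carries the scale factor `(Lʲη)⁻²` (the operator is SMALLER at coarse levels) and the decay `e^{−δ₀d}` — NEITHER is proved here: this is the uniform `O(1)`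
operator bound, the `L²` shadow of Thm 3.11's third positivity.  NON-VACUITY (A6): every `G`-valued `U` (e.g. `U ≡ 1`, pure gauges, the class (3.35)).
HONEST SCOPE.  Finite-dimensional consequences of two proved form bounds and one isometry; NOT a node discharge, NOT summit progress; count-neutral; nothing
continuum ∕ OS ∕ mass gap ∕ Clay.  NEW file importing file 4 and dag-n06-j's `B9Thm311PosAtRecordV4` only.  Net new unproved facts: 0.
-/

noncomputable section

namespace Literature.MathematicalPhysics.QuantumFieldTheory.Balaban1983to89.B9Thm32SiteXBoundsY

open Literature.MathematicalPhysics.QuantumFieldTheory.Balaban1983to89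
open Node00 B6KLevelCensusIndexV1 B6Geom246MultiLevelBox B6MultiLevelBoxOperator B6MultiLevelTorusOperator B6GlobalChartV1 B9BackgroundsKLevelV1
  B9Eq39Adjoint B9Thm311ReadingCoords B9Thm311DeltaPrimePos B9Ineq369CurvatureSmallAtLettersY B9Thm31SiteCoerciveGaugeBlockY
  B9Thm31SiteCoerciveReg335Y B9Thm31SiteGpBoundsReg335Y
open Literature.MathematicalPhysics.QuantumFieldTheory.Balaban1983to89.B9Ineq349SiteAdjoint (trIP_comm isSymmTr_GpY_parSymY)
open Literature.MathematicalPhysics.QuantumFieldTheory.Balaban1983to89.B9Thm311AdjointAtLetters (QpsY_apply_eq)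
open Literature.MathematicalPhysics.QuantumFieldTheory.Balaban1983to89.B9Thm311AdjointPairs (isSymmTr_sandwich_of_isAdjTr)
open Literature.MathematicalPhysics.QuantumFieldTheory.Balaban1983to89.B9Thm311SymmAtRecordV4 (adj_parSymY)
open Literature.MathematicalPhysics.QuantumFieldTheory.Balaban1983to89.B9Thm311ReadingAtLetters (wB wB_pos)
open Literature.MathematicalPhysics.QuantumFieldTheory.Balaban1983to89.B9Thm311PosAtRecordV4 (isUnit_XY_parSymY)
open Literature.MathematicalPhysics.QuantumFieldTheory.Balaban1983to89.B4Lower18 (card_filter_rblk)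
open scoped Matrix Matrix.Norms.L2Operator

/-! ## §1 Bookkeeping: the form-to-norm step, the isometry `‖Q′*g‖₁ = ‖g‖_W`, the form of `Q′G′²Q′*` -/

section Book

variable {S : Type} [Fintype S] {N : ℕ}

/-- if `‖Ψ‖² ≤ M⟨Ψ, TΨ⟩` for all `Ψ` then `‖Ψ‖² ≤ M²‖TΨ‖²` (Cauchy–Schwarz). [cite: Balaban1985BackgroundPropagators, Thm 3.11 p.416, bookkeeping] -/
theorem trIP_self_le_sq_mul_of_le {w : S → ℝ} (hw : ∀ s, 0 < w s) {T : (S → Matrix (Fin N) (Fin N) ℂ) → (S → Matrix (Fin N) (Fin N) ℂ)} {M : ℝ}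
    (h : ∀ Ψ, trIP w Ψ Ψ ≤ M * trIP w Ψ (T Ψ)) (Ψ : S → Matrix (Fin N) (Fin N) ℂ) :
    trIP w Ψ Ψ ≤ M ^ 2 * trIP w (T Ψ) (T Ψ) := by
  have ha : 0 ≤ trIP w Ψ Ψ := trIP_self_nonneg w hw Ψ
  have hb : 0 ≤ trIP w (T Ψ) (T Ψ) := trIP_self_nonneg w hw _
  have hx := h Ψ
  have hcs := trIP_sq_le w hw Ψ (T Ψ)
  have h3 : (trIP w Ψ Ψ) ^ 2 ≤ M ^ 2 * (trIP w Ψ Ψ * trIP w (T Ψ) (T Ψ)) := by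
    calc (trIP w Ψ Ψ) ^ 2 ≤ (M * trIP w Ψ (T Ψ)) ^ 2 := pow_le_pow_left₀ ha hx 2
      _ = M ^ 2 * trIP w Ψ (T Ψ) ^ 2 := by ring
      _ ≤ M ^ 2 * (trIP w Ψ Ψ * trIP w (T Ψ) (T Ψ)) := mul_le_mul_of_nonneg_left hcs (sq_nonneg M)
  rcases ha.eq_or_lt with h0 | hpos
  · rw [← h0]; exact mul_nonneg (sq_nonneg M) hb
  · have h4 : trIP w Ψ Ψ * trIP w Ψ Ψ ≤ (M ^ 2 * trIP w (T Ψ) (T Ψ)) * trIP w Ψ Ψ := by nlinarith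
    exact le_of_mul_le_mul_right h4 hpos

end Book

section Letters

variable {d ℓ : ℕ} {hd : 1 ≤ d + 1} {hL : Odd (ℓ + 1) ∧ 1 < ℓ + 1} {b₀ b₁ : ℝ}
variable (i : KIdx d ℓ hd hL b₀ b₁) {N : ℕ} {G : Subgroup (Matrix (Fin N) (Fin N) ℂ)ˣ}

/-- ★ **`Q′\*(U)` IS AN ISOMETRY FROM THE BLOCK-VOLUME NORM**: `‖Q′\*(U)g‖²₁ = Σ_s W_s·HS(g s) = ‖g‖²_W` for a `G`-valued transporter table, `G ≤ U(N)`
(`(Q′\*g)(z) = R(U(Γ_{c,z}))⁻¹g(s_z)`, a unitary conjugate of `g` on each of the `W_s = n_s^{d+1}` sites of the block).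
[cite: Balaban1985BackgroundPropagators, (3.19) p.393, p.393 (Q′* the adjoint of Q′); Balaban1984PropagatorsII, (2.69) p.235] -/
theorem trIP_one_QpsY_self_eq (hG : G ≤ B7Prop2Explicit.unitaryUnits (Matrix (Fin N) (Fin N) ℂ))
    (parS : SiteParY (Matrix (Fin N) (Fin N) ℂ) i) (U : CfgY (Matrix (Fin N) (Fin N) ℂ) i) (hpar : ∀ z w : SiteY i, parS U z w ∈ G)
    (g : BlkY i → Matrix (Fin N) (Fin N) ℂ) :
    trIP (fun _ => (1 : ℝ)) (QpsY i parS U g) (QpsY i parS U g) = trIP (wB i) g g := by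
  rw [trIP_one_self_eq, trIP_eq_re_trace]
  -- each site carries `HS(g(s_z))`
  have hz : ∀ z : SiteY i, ∑ a, ∑ b, ‖QpsY i parS U g z a b‖ ^ 2 = ∑ a, ∑ b, ‖g (blkOf i.D.toDomains z) a b‖ ^ 2 := by
    intro z
    rw [QpsY_apply_eq]
    have hmem : qpT i parS U (blkOf i.D.toDomains z) z ∈ G := hpar _ _
    have hc := contractive_of_mem_unitary (V := (qpT i parS U (blkOf i.D.toDomains z) z)⁻¹) (hG (G.inv_mem hmem))
    exact hs_R_eq_of_contraction hc _
  rw [Finset.sum_congr rfl fun z _ => hz z,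
    ← Finset.sum_fiberwise Finset.univ (fun z : SiteY i => blkOf i.D.toDomains z) (fun z => ∑ a, ∑ b, ‖g (blkOf i.D.toDomains z) a b‖ ^ 2)]
  refine Finset.sum_congr rfl fun s _ => ?_
  have hconst : ∑ z ∈ Finset.univ.filter (fun z : SiteY i => blkOf i.D.toDomains z = s), ∑ a, ∑ b, ‖g (blkOf i.D.toDomains z) a b‖ ^ 2
      = ∑ z ∈ Finset.univ.filter (fun z : SiteY i => blkOf i.D.toDomains z = s), ∑ a, ∑ b, ‖g s a b‖ ^ 2 :=
    Finset.sum_congr rfl fun z hz => by rw [(Finset.mem_filter.1 hz).2]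
  have hcard : ((Finset.univ.filter (fun z : SiteY i => blkOf i.D.toDomains z = s)).card : ℝ) = wB i s := by
    rw [← filter_rblk_eq_filter_blkOf i s,
      card_filter_rblk (le_trans one_le_two (two_le_side i s)) (isBlockUnion_XB i (scale_bounds i.D.toDomains s).2)]
    have hW : wB i s = (((ℓ : ℝ) + 1) ^ s.1.1) ^ (d + 1) := B6Ineq268MultiLevelBox.W_eq i.D.toDomains s
    rw [hW]
    push_cast; ring
  rw [hconst, Finset.sum_const, nsmul_eq_mul, hcard, hs_eq_re_trace]

/-- THE FORM OF `Q′G′²Q′\*` at def-Y's symmetrised table: `⟨g, (Q′G′²Q′\*)(U)g⟩_W = ‖G′(U)Q′\*(U)g‖²₁` for every `G`-valued `U`, `G ≤ U(N)` (adjointness of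
`Q′, Q′\*` and the symmetry of `G′`). [cite: Balaban1985BackgroundPropagators, (3.25) pp.394–395; Balaban1984PropagatorsI, p.25] -/
theorem trIP_wB_XY_eq (hG : G ≤ B7Prop2Explicit.unitaryUnits (Matrix (Fin N) (Fin N) ℂ)) {U : CfgY (Matrix (Fin N) (Fin N) ℂ) i}
    (hU : ∀ μ x, U μ x ∈ G) (g : BlkY i → Matrix (Fin N) (Fin N) ℂ) :
    trIP (wB i) g (XY i (parSymY i) (GpY i (parSymY i)) U g)
      = trIP (fun _ => (1 : ℝ)) (GpY i (parSymY i) U (QpsY i (parSymY i) U g)) (GpY i (parSymY i) U (QpsY i (parSymY i) U g)) := by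
  have hadj := adj_parSymY i hG hU
  show trIP (wB i) g (QpY i (parSymY i) U (GpY i (parSymY i) U (GpY i (parSymY i) U (QpsY i (parSymY i) U g)))) = _
  rw [trIP_comm, hadj, trIP_comm, isSymmTr_GpY_parSymY i hG hU]

/-- `(Q′G′²Q′\*)(U)` is symmetric for the block-volume pairing at every `G`-valued `U`, `G ≤ U(N)`. [cite: Balaban1985BackgroundPropagators, Thm 3.11 p.416 («symmetric»)] -/
theorem isSymmTr_XY_parSymY (hG : G ≤ B7Prop2Explicit.unitaryUnits (Matrix (Fin N) (Fin N) ℂ)) {U : CfgY (Matrix (Fin N) (Fin N) ℂ) i}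
    (hU : ∀ μ x, U μ x ∈ G) : IsSymmTr (wB i) (XY i (parSymY i) (GpY i (parSymY i)) U) := by
  have hGG : IsSymmTr (fun _ => (1 : ℝ)) (GpY i (parSymY i) U ∘ₗ GpY i (parSymY i) U) := by
    intro Φ Ψ
    simp only [LinearMap.comp_apply]
    rw [isSymmTr_GpY_parSymY i hG hU, isSymmTr_GpY_parSymY i hG hU]
  have h := isSymmTr_sandwich_of_isAdjTr (B9Thm311AdjointPairs.isAdjTr_swap (adj_parSymY i hG hU)) hGG
  -- `XY = Q′ ∘ (G′ ∘ G′) ∘ Q′*`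
  have e : XY i (parSymY i) (GpY i (parSymY i)) U = QpY i (parSymY i) U ∘ₗ (GpY i (parSymY i) U ∘ₗ GpY i (parSymY i) U) ∘ₗ QpsY i (parSymY i) U := rfl
  rw [e]
  exact h

end Letters

/-! ## §2 The two-sided bounds of `(Q′G′²Q′*)(U)` and of `C(U) = (Q′G′²Q′*)⁻¹(U)` -/

section Main

variable {d ℓ : ℕ} {hd : 1 ≤ d + 1} {hL : Odd (ℓ + 1) ∧ 1 < ℓ + 1} {b₀ b₁ : ℝ}
variable (i : KIdx d ℓ hd hL b₀ b₁) {N : ℕ} {G : Subgroup (Matrix (Fin N) (Fin N) ℂ)ˣ}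

/-- ★★★ **THE UNIFORM COERCIVITY OF `(Q′G′²Q′\*)(U)` AT EVERY `G`-VALUED BACKGROUND** (`G ≤ U(N)`, NO smallness): `(4(d+1)+1)⁻²·‖g‖²_W ≤ ⟨g, (Q′G′²Q′\*)(U)g⟩_W`
— Theorem 3.11's third positivity with a constant free of the member, the volume, `k`, `N` and `U`. [cite: Balaban1985BackgroundPropagators, (3.25) p.395, Thm 3.11 p.416, Thm 3.2 p.398; Balaban1984PropagatorsII, Prop 2.3 p.238] -/
theorem trIP_XY_parSymY_ge (hG : G ≤ B7Prop2Explicit.unitaryUnits (Matrix (Fin N) (Fin N) ℂ)) {U : CfgY (Matrix (Fin N) (Fin N) ℂ) i}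
    (hU : ∀ μ x, U μ x ∈ G) (g : BlkY i → Matrix (Fin N) (Fin N) ℂ) :
    ((4 * ((d : ℝ) + 1) + 1) ^ 2)⁻¹ * trIP (wB i) g g ≤ trIP (wB i) g (XY i (parSymY i) (GpY i (parSymY i)) U g) := by
  rw [trIP_wB_XY_eq i hG hU, ← trIP_one_QpsY_self_eq i hG (parSymY i) U (fun z w => parSymY_mem i hU z w) g]
  have hM0 : (0 : ℝ) < (4 * ((d : ℝ) + 1) + 1) ^ 2 := by positivity
  have h := trIP_self_le_sq_mul_of_le (fun _ => one_pos) (T := fun Ψ => GpY i (parSymY i) U Ψ) (fun Ψ => trIP_self_le_GpY_parSymY i hG hU Ψ)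
    (QpsY i (parSymY i) U g)
  rw [inv_mul_le_iff₀ hM0]
  exact h

/-- ★★ **THE UPPER BOUND ON THE CLASS (3.35)**: `⟨g, (Q′G′²Q′\*)(U)g⟩_W ≤ (8(L^k)²)²·‖g‖²_W` for `U ∈ Reg335 c α₀`, `c·M·α₀·(d+1) ≤ 1∕16`, `N ≥ 1`
(`‖G′Q′\*g‖ ≤ 8L^{2k}‖Q′\*g‖ = 8L^{2k}‖g‖_W`). [cite: Balaban1985BackgroundPropagators, Thm 3.1 p.397, Thm 3.2 p.398, (3.35) p.396] -/
theorem trIP_XY_parSymY_le [Nonempty (Fin N)] (hG : G ≤ B7Prop2Explicit.unitaryUnits (Matrix (Fin N) (Fin N) ℂ))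
    {U : CfgY (Matrix (Fin N) (Fin N) ℂ) i} {c α₀ : ℝ} (hC0 : 0 ≤ c * (kGeo i).M * α₀) (hC1 : c * (kGeo i).M * α₀ * ((d : ℝ) + 1) ≤ 1 / 16)
    (hreg : (bg9K (Matrix (Fin N) (Fin N) ℂ) G i).Reg335 c α₀ U) (g : BlkY i → Matrix (Fin N) (Fin N) ℂ) :
    trIP (wB i) g (XY i (parSymY i) (GpY i (parSymY i)) U g) ≤ (8 * ((((ℓ + 1) ^ i.k : ℕ) : ℝ)) ^ 2) ^ 2 * trIP (wB i) g g := by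
  rw [trIP_wB_XY_eq i hG hreg.1, ← trIP_one_QpsY_self_eq i hG (parSymY i) U (fun z w => parSymY_mem i hreg.1 z w) g]
  exact trIP_GpY_parSymY_self_le i hG hC0 hC1 hreg _

/-- ★★★ **`C(U) = (Q′G′²Q′\*)⁻¹(U)` IS UNIFORMLY BOUNDED**: `‖C(U)h‖²_W ≤ ((4(d+1)+1)²)²·‖h‖²_W` at every `G`-valued `U`, `G ≤ U(N)` — def-Y's `XinvY i (parSymY i)
(GpY i (parSymY i)) U`, the genuine two-sided inverse (dag-n06-j's `isUnit_XY_parSymY`). [cite: Balaban1985BackgroundPropagators, Thm 3.2 p.398, (3.25) p.395, Thm 3.11 p.416] -/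
theorem trIP_XinvY_parSymY_self_le (hG : G ≤ B7Prop2Explicit.unitaryUnits (Matrix (Fin N) (Fin N) ℂ)) {U : CfgY (Matrix (Fin N) (Fin N) ℂ) i}
    (hU : ∀ μ x, U μ x ∈ G) (h : BlkY i → Matrix (Fin N) (Fin N) ℂ) :
    trIP (wB i) (XinvY i (parSymY i) (GpY i (parSymY i)) U h) (XinvY i (parSymY i) (GpY i (parSymY i)) U h)
      ≤ ((4 * ((d : ℝ) + 1) + 1) ^ 2) ^ 2 * trIP (wB i) h h := by
  have hm : (0 : ℝ) < ((4 * ((d : ℝ) + 1) + 1) ^ 2)⁻¹ := by positivity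
  have hb := trIP_ringInverse_self_le (wB_pos i) hm (fun g => trIP_XY_parSymY_ge i hG hU g) h
  have hX : XinvY i (parSymY i) (GpY i (parSymY i)) U = Ring.inverse (XY i (parSymY i) (GpY i (parSymY i)) U) := rfl
  rw [hX]
  have hM0 : (0 : ℝ) < (4 * ((d : ℝ) + 1) + 1) ^ 2 := by positivity
  have e : ((4 * ((d : ℝ) + 1) + 1) ^ 2) ^ 2 * ((((4 * ((d : ℝ) + 1) + 1) ^ 2)⁻¹) ^ 2) = 1 := by field_simp
  calc trIP (wB i) (Ring.inverse (XY i (parSymY i) (GpY i (parSymY i)) U) h) (Ring.inverse (XY i (parSymY i) (GpY i (parSymY i)) U) h)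
      = ((4 * ((d : ℝ) + 1) + 1) ^ 2) ^ 2 * (((((4 * ((d : ℝ) + 1) + 1) ^ 2)⁻¹) ^ 2) *
          trIP (wB i) (Ring.inverse (XY i (parSymY i) (GpY i (parSymY i)) U) h) (Ring.inverse (XY i (parSymY i) (GpY i (parSymY i)) U) h)) := by
        rw [← mul_assoc, e, one_mul]
    _ ≤ ((4 * ((d : ℝ) + 1) + 1) ^ 2) ^ 2 * trIP (wB i) h h := mul_le_mul_of_nonneg_left hb (by positivity)

/-- ★★ **THE FORM OF `C(U)` IS UNIFORMLY BOUNDED**: `⟨h, C(U)h⟩_W ≤ (4(d+1)+1)²·‖h‖²_W` at every `G`-valued `U`, `G ≤ U(N)`.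
[cite: Balaban1985BackgroundPropagators, Thm 3.2 p.398, Thm 3.11 p.416] -/
theorem trIP_XinvY_parSymY_le (hG : G ≤ B7Prop2Explicit.unitaryUnits (Matrix (Fin N) (Fin N) ℂ)) {U : CfgY (Matrix (Fin N) (Fin N) ℂ) i}
    (hU : ∀ μ x, U μ x ∈ G) (h : BlkY i → Matrix (Fin N) (Fin N) ℂ) :
    trIP (wB i) h (XinvY i (parSymY i) (GpY i (parSymY i)) U h) ≤ (4 * ((d : ℝ) + 1) + 1) ^ 2 * trIP (wB i) h h := by
  have hm : (0 : ℝ) < ((4 * ((d : ℝ) + 1) + 1) ^ 2)⁻¹ := by positivity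
  have hb := trIP_ringInverse_le (wB_pos i) hm (fun g => trIP_XY_parSymY_ge i hG hU g) h
  have hX : XinvY i (parSymY i) (GpY i (parSymY i)) U = Ring.inverse (XY i (parSymY i) (GpY i (parSymY i)) U) := rfl
  rw [hX]
  have hM0 : (0 : ℝ) < (4 * ((d : ℝ) + 1) + 1) ^ 2 := by positivity
  rwa [inv_mul_le_iff₀ hM0] at hb

/-- ★★ **`C(U)` IS BOUNDED BELOW ON THE CLASS**: `‖h‖²_W ≤ (8(L^k)²)²·⟨h, C(U)h⟩_W` for `U ∈ Reg335 c α₀`, `c·M·α₀·(d+1) ≤ 1∕16`, `N ≥ 1` (the upper bound of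
`Q′G′²Q′\*` transported to its symmetric positive inverse). [cite: Balaban1985BackgroundPropagators, Thm 3.2 p.398, Thm 3.11 p.416, (3.35) p.396] -/
theorem trIP_self_le_XinvY_parSymY [Nonempty (Fin N)] (hG : G ≤ B7Prop2Explicit.unitaryUnits (Matrix (Fin N) (Fin N) ℂ))
    {U : CfgY (Matrix (Fin N) (Fin N) ℂ) i} {c α₀ : ℝ} (hC0 : 0 ≤ c * (kGeo i).M * α₀) (hC1 : c * (kGeo i).M * α₀ * ((d : ℝ) + 1) ≤ 1 / 16)
    (hreg : (bg9K (Matrix (Fin N) (Fin N) ℂ) G i).Reg335 c α₀ U) (h : BlkY i → Matrix (Fin N) (Fin N) ℂ) :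
    trIP (wB i) h h ≤ (8 * ((((ℓ + 1) ^ i.k : ℕ) : ℝ)) ^ 2) ^ 2 * trIP (wB i) h (XinvY i (parSymY i) (GpY i (parSymY i)) U h) := by
  have hU : ∀ μ x, U μ x ∈ G := hreg.1
  have hpos : ∀ g, 0 ≤ trIP (wB i) g (XY i (parSymY i) (GpY i (parSymY i)) U g) := fun g =>
    le_trans (mul_nonneg (inv_nonneg.2 (by positivity)) (trIP_self_nonneg _ (wB_pos i) g)) (trIP_XY_parSymY_ge i hG hU g)
  have hM : (0 : ℝ) < (8 * ((((ℓ + 1) ^ i.k : ℕ) : ℝ)) ^ 2) ^ 2 := by positivity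
  exact trIP_self_le_ringInverse_of_symm (isSymmTr_XY_parSymY i hG hU) hpos hM (fun g => trIP_XY_parSymY_le i hG hC0 hC1 hreg g)
    (isUnit_XY_parSymY i hG hU) h

end Main

end Literature.MathematicalPhysics.QuantumFieldTheory.Balaban1983to89.B9Thm32SiteXBoundsY
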